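/-
Copyright (c) 2026. All rights reserved.
Released under Apache 2.0 license as described in the file LICENSE.
Authors: abc-iut cell, prover seat abc-iut-w5-d096 (gen 8; abc-iut-L4-lead m134 «GO w5-d096 ALPHA-FACT-NAME»: the
topological input (α) of the punctured cell of the [AbsTopIII] Prop 4.2 (i) / Cor 4.5 geometric column, as a NAMED
classical fact with locator — statement only, no new mathematics).
-/
import Literature.IUT.HodgeTheaters.DiscreteProfiniteConjugates
import Mathlib.Geometry.Manifold.IsManifold.Basic
import Mathlib.Analysis.Complex.Basic
import Mathlib.AlgebraicTopology.FundamentalGroupoid.FundamentalGroup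
import HarnessLib

/-!
# The fundamental group of a punctured compact (Riemann) surface is free of finite rank (Massey, Ch. 4 §5) — named fact

W. S. Massey, *Algebraic Topology: An Introduction*, GTM 56 (Springer 1977; Harcourt, Brace & World 1967), Chapter 4
(«The fundamental group: applications»), §5 (the fundamental groups of compact surfaces and of surfaces with boundary /
punctures): a compact connected orientable surface of genus `g` with `r ≥ 1` points removed deformation retracts onto a
wedge of `2g + r − 1` circles, so its fundamental group is FREE of rank `2g + r − 1` [cite: Massey1967AlgebraicTopology,
Ch. 4 §5].  (Equivalent classical sources: J. Stillwell, *Classical Topology and Combinatorial Group Theory* §4.2.2;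
every Riemann surface is orientable.)

WHY THIS FILE (abc-iut cell, [AbsTopIII] Prop 4.2 (i) / Cor 4.5 geometric column, PUNCTURED cell).  The zero-residual
closer `HolRS.isIdRigid_EA_and_cor_4_5_full_mapsTo_of_isOfFiniteType` (abc-iut-w5-d096,
`ArchimedeanHolFieldFunctorGeometricPSLPuncturedGenuineZeroResidual`) carries exactly one topological binder at punctured
genus `≥ 2`: `hπ : IsFreeOrSurface (π₁ X)`.  The tree computes `π₁` of punctured surfaces only for genus `≤ 1`
(`ℂ ∖ F`: `nonempty_mulEquiv_freeGroup_compl_finite`; torus minus a finite set: `TorusMinusFinite.…`); the general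
statement needs a CW model / the classification of compact surfaces (campaign-L; abc-iut-w5-d038's ALPHA-CENSUS, routes
R1–R6).  Per abc-iut-L4-lead m134 the binder is therefore recorded here as a NAMED CLASSICAL FACT with locator, in the
tree's Riemann-surface vocabulary (`ChartedSpace ℂ`, `IsManifold 𝓘(ℂ, ℂ) ω`; `IsFreeOfFiniteRank` of abc-iut-L5
`DiscreteProfiniteConjugates`), so that consumers can cite it BY NAME.  A `def … : Prop`, QUOTED not asserted; no
`theorem … _holds` is claimed.

* `PuncturedCompactRiemannSurfaceFreePi1` — for a compact connected Riemann surface `M` and a finite non-empty `S ⊆ M` with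
  `M ∖ S` connected, `π₁(M ∖ S, x)` is free of finite rank (the WEAKENED form the consumer needs: the rank `2g + r − 1` is
  not recorded — the tree has no genus for compact Riemann surfaces; `-- TODO(general form)` below).

Classical algebraic topology; nothing here bears on [IUTchIII] Cor. 3.12; no side taken.
-/

namespace Literature.AlgebraicTopology.FundamentalGroup

open scoped Manifold ContDiff
open Literature.IUT.HodgeTheaters (IsFreeOfFiniteRank)

/-- **The fundamental group of a punctured compact Riemann surface is free of finite rank** (Massey, *Algebraic Topology:
An Introduction*, Ch. 4 §5: a compact connected orientable surface of genus `g` minus `r ≥ 1` points deformation retracts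
onto a wedge of `2g + r − 1` circles; Riemann surfaces are orientable).  Typed, in the tree's vocabulary: for `M` a compact
connected Riemann surface (`ChartedSpace ℂ M`, `IsManifold 𝓘(ℂ, ℂ) ω M`, Hausdorff), `S ⊆ M` finite and non-empty with
`M ∖ S` connected, and any base point `x ∈ M ∖ S`, the fundamental group `π₁(M ∖ S, x)` is isomorphic to a free group
`F_n` on finitely many generators (`IsFreeOfFiniteRank`).  Named `Prop` fact (statement only; not asserted).
-- TODO(general form): Massey gives the rank, `n = 2g + r − 1` with `g` the genus of `M` and `r = |S|`; the tree has no
-- notion of genus for a compact Riemann surface, so only «free of finite rank» is recorded.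
[cite: Massey1967AlgebraicTopology, Ch. 4 §5] -/
def PuncturedCompactRiemannSurfaceFreePi1 : Prop :=
  ∀ (M : Type) [TopologicalSpace M] [T2Space M] [CompactSpace M] [ConnectedSpace M] [ChartedSpace ℂ M]
    [IsManifold 𝓘(ℂ, ℂ) ω M] (S : Set M), S.Finite → S.Nonempty → IsConnected (Sᶜ : Set M) →
    ∀ x : ↥(Sᶜ : Set M), IsFreeOfFiniteRank (FundamentalGroup (↥(Sᶜ : Set M)) x)

end Literature.AlgebraicTopology.FundamentalGroup
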